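import Summits.AnomalousDissipation.AnomalousDissipation.Theorems.SolenoidalFractalHomogenisationLagrangianStepWindowLedger
import HarnessLib

/-!
# K1L_D (stmt-AnomalousDissipation-27980), S23‴: the TELESCOPED DUALITY along the adjoint-coarse chain (L4c §3.1 backbone)
# (helper; `--supports … --as helper`)

For window maps `T k` (the coarse/effective propagators), an arbitrary "true" chain `u` and the coarse chain `v` from the same datum
(`v 0 = u 0`, `v (k+1) = T k (v k)`), with window errors `e k := u (k+1) − T k (u k)`, the final discrepancy tested against `z` telescopes EXACTLY
along any ADJOINT-COARSE chain `ψ` (`ψ K = z`, `ψ k = (T k)† ψ (k+1)` for `k < K`; for propagators `ψ k = (Um (t_k) (t))† z` explicitly):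
`⟪z, u K − v K⟫ = Σ_{k<K} ⟪ψ (k+1), e k⟫`, and `‖ψ k‖ ≤ ‖z‖` for contractions.  The label-split ledger (p4 g12 L4c §3 / lead F-lead-9) bounds the
`z`-part of each summand by `dd_assembly_op` and the `h`-part by localisation.  Pure Hilbert-space algebra (no definitions).  Infrastructure for rung
F-D1.A0; NOT a proof of the crux or of anomalous dissipation.
-/

set_option linter.dupNamespace false

namespace Summit.AnomalousDissipation.AnomalousDissipation.Theorems.SolenoidalFractalHomogenisation.LagrangianStep

open scoped InnerProductSpace

variable {V : Type*} [NormedAddCommGroup V] [InnerProductSpace ℝ V] [CompleteSpace V]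

/-- An adjoint-coarse chain of contractions does not grow: `‖ψ k‖ ≤ ‖ψ K‖` for `k ≤ K`. -/
theorem norm_chain_le (T : ℕ → V →L[ℝ] V) (hT : ∀ k x, ‖T k x‖ ≤ ‖x‖) (K : ℕ) (ψ : ℕ → V)
    (hψ : ∀ k, k < K → ψ k = ContinuousLinearMap.adjoint (T k) (ψ (k + 1))) :
    ∀ n, n ≤ K → ‖ψ (K - n)‖ ≤ ‖ψ K‖ := by
  intro n
  induction n with
  | zero => intro _; simp
  | succ n ih =>
    intro hn
    have hlt : K - (n + 1) < K := by omega
    rw [hψ _ hlt, show K - (n + 1) + 1 = K - n by omega]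
    exact (norm_adjoint_apply_le_of_contraction (hT _) _).trans (ih (by omega))

/-- **Telescoped duality along an adjoint-coarse chain.**  If `v 0 = u 0`, `v (k+1) = T k (v k)`, `ψ K = z` and `ψ k = (T k)† ψ (k+1)` for `k < K`,
then `⟪z, u K − v K⟫ = Σ_{k<K} ⟪ψ (k+1), u (k+1) − T k (u k)⟫`. -/
theorem inner_sub_eq_sum_chain (T : ℕ → V →L[ℝ] V) (u v : ℕ → V) (h0 : v 0 = u 0) (hv : ∀ k, v (k + 1) = T k (v k)) :
    ∀ (K : ℕ) (ψ : ℕ → V), (∀ k, k < K → ψ k = ContinuousLinearMap.adjoint (T k) (ψ (k + 1))) →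
      ⟪ψ K, u K - v K⟫_ℝ = ∑ k ∈ Finset.range K, ⟪ψ (k + 1), u (k + 1) - T k (u k)⟫_ℝ := by
  intro K
  induction K with
  | zero => intro ψ _; simp [h0]
  | succ K ih =>
    intro ψ hψ
    have hsplit : u (K + 1) - v (K + 1) = (u (K + 1) - T K (u K)) + T K (u K - v K) := by
      rw [hv K, map_sub]; abel
    rw [hsplit, inner_add_right, Finset.sum_range_succ, add_comm]
    congr 1
    rw [← ContinuousLinearMap.adjoint_inner_left, ← hψ K (Nat.lt_succ_self K)]
    exact ih ψ fun k hk => hψ k (Nat.lt_succ_of_lt hk)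

/-- **Bound form**: with per-window pairing bounds `|⟪ψ (k+1), e k⟫| ≤ B k` along the chain, `|⟪z, u K − v K⟫| ≤ Σ_{k<K} B k`. -/
theorem abs_inner_sub_le_sum_chain (T : ℕ → V →L[ℝ] V) (u v : ℕ → V) (h0 : v 0 = u 0) (hv : ∀ k, v (k + 1) = T k (v k))
    (K : ℕ) (ψ : ℕ → V) (hψ : ∀ k, k < K → ψ k = ContinuousLinearMap.adjoint (T k) (ψ (k + 1))) (B : ℕ → ℝ)
    (hB : ∀ k, k < K → |⟪ψ (k + 1), u (k + 1) - T k (u k)⟫_ℝ| ≤ B k) :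
    |⟪ψ K, u K - v K⟫_ℝ| ≤ ∑ k ∈ Finset.range K, B k := by
  rw [inner_sub_eq_sum_chain T u v h0 hv K ψ hψ]
  exact (Finset.abs_sum_le_sum_abs _ _).trans (Finset.sum_le_sum fun k hk => hB k (Finset.mem_range.mp hk))

end Summit.AnomalousDissipation.AnomalousDissipation.Theorems.SolenoidalFractalHomogenisation.LagrangianStep
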